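import Summits.Ventures.PercRepro.G3Class

/-!
# The kernel chunks of the G₃ class sums, part A1 (p6, gen 6; split gen 7 for the gate's 600-s elaboration budget)

Sure-set groups `0`–`5` of the `G3ClassA` lineage: `iGroup_g` with contiguous segments of `subsetsS3`,
each theorem `classOK_g_j` a closed Boolean check of ≤ 2,200 values of `kA3` by `decide +kernel`, `mem_seg_g` (the segments
cover the sure sets, kernel) and the group dispatch `classOK_g`.  Statements, names and proofs are those of `G3ClassA`
(gen 6); only the file boundary changed.  Assembled in `G3ClassAll.lean`.
-/

-- the kernel chunks below are heavy; elaborate them one at a time (memory)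
set_option Elab.async false

namespace PercRepro

open Finset

/-- Sure-set group `0` (1 sets). -/
def iGroup0 : List (Finset (Fin 9)) :=
  [∅]

/-- Kernel chunk `0.0`: every `U` in this segment of `subsetsS3` passes `classOKpair I U` for all `I` of group `0`. -/ theorem classOK_0_0 : iGroup0.all (fun I => ((subsetsS3.drop 0).take 23).all (classOKpair I)) = true := by
  decide +kernel

/-- Kernel chunk `0.1`: every `U` in this segment of `subsetsS3` passes `classOKpair I U` for all `I` of group `0`. -/ theorem classOK_0_1 : iGroup0.all (fun I => ((subsetsS3.drop 23).take 54).all (classOKpair I)) = true := by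
  decide +kernel

/-- Kernel chunk `0.2`: every `U` in this segment of `subsetsS3` passes `classOKpair I U` for all `I` of group `0`. -/ theorem classOK_0_2 : iGroup0.all (fun I => ((subsetsS3.drop 77).take 174).all (classOKpair I)) = true := by
  decide +kernel

/-- Kernel chunk `0.3`: every `U` in this segment of `subsetsS3` passes `classOKpair I U` for all `I` of group `0`. -/ theorem classOK_0_3 : iGroup0.all (fun I => ((subsetsS3.drop 251).take 5).all (classOKpair I)) = true := by
  decide +kernel

/-- Every `U ⊆ S3` lies in one of the segments of `subsetsS3` used by group `0` (kernel-checked). -/ theorem mem_seg_0 : ∀ U : Finset (Fin 9), U ⊆ S3 → U ∈ (subsetsS3.drop 0).take 23 ∨ U ∈ (subsetsS3.drop 23).take 54 ∨ U ∈ (subsetsS3.drop 77).take 174 ∨ U ∈ (subsetsS3.drop 251).take 5 := by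
  decide +kernel

/-- Class-level check for group `0`: all `(I, U)` with `I` in the group and `U ⊆ S3` pass `classOKpair`. -/ theorem classOK_0 : ∀ I ∈ iGroup0, ∀ U : Finset (Fin 9), U ⊆ S3 → classOKpair I U = true := by
  intro I hI U hU
  rcases mem_seg_0 U hU with h0 | h1 | h2 | h3
  · exact List.all_eq_true.mp (List.all_eq_true.mp classOK_0_0 I hI) U h0
  · exact List.all_eq_true.mp (List.all_eq_true.mp classOK_0_1 I hI) U h1
  · exact List.all_eq_true.mp (List.all_eq_true.mp classOK_0_2 I hI) U h2
  · exact List.all_eq_true.mp (List.all_eq_true.mp classOK_0_3 I hI) U h3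

/-- Sure-set group `1` (1 sets). -/
def iGroup1 : List (Finset (Fin 9)) :=
  [{0}]

/-- Kernel chunk `1.0`: every `U` in this segment of `subsetsS3` passes `classOKpair I U` for all `I` of group `1`. -/ theorem classOK_1_0 : iGroup1.all (fun I => ((subsetsS3.drop 0).take 175).all (classOKpair I)) = true := by
  decide +kernel

/-- Kernel chunk `1.1`: every `U` in this segment of `subsetsS3` passes `classOKpair I U` for all `I` of group `1`. -/ theorem classOK_1_1 : iGroup1.all (fun I => ((subsetsS3.drop 175).take 81).all (classOKpair I)) = true := by
  decide +kernel

/-- Every `U ⊆ S3` lies in one of the segments of `subsetsS3` used by group `1` (kernel-checked). -/ theorem mem_seg_1 : ∀ U : Finset (Fin 9), U ⊆ S3 → U ∈ (subsetsS3.drop 0).take 175 ∨ U ∈ (subsetsS3.drop 175).take 81 := by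
  decide +kernel

/-- Class-level check for group `1`: all `(I, U)` with `I` in the group and `U ⊆ S3` pass `classOKpair`. -/ theorem classOK_1 : ∀ I ∈ iGroup1, ∀ U : Finset (Fin 9), U ⊆ S3 → classOKpair I U = true := by
  intro I hI U hU
  rcases mem_seg_1 U hU with h0 | h1
  · exact List.all_eq_true.mp (List.all_eq_true.mp classOK_1_0 I hI) U h0
  · exact List.all_eq_true.mp (List.all_eq_true.mp classOK_1_1 I hI) U h1

/-- Sure-set group `2` (1 sets). -/
def iGroup2 : List (Finset (Fin 9)) :=
  [{1}]

/-- Kernel chunk `2.0`: every `U` in this segment of `subsetsS3` passes `classOKpair I U` for all `I` of group `2`. -/ theorem classOK_2_0 : iGroup2.all (fun I => ((subsetsS3.drop 0).take 186).all (classOKpair I)) = true := by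
  decide +kernel

/-- Kernel chunk `2.1`: every `U` in this segment of `subsetsS3` passes `classOKpair I U` for all `I` of group `2`. -/ theorem classOK_2_1 : iGroup2.all (fun I => ((subsetsS3.drop 186).take 70).all (classOKpair I)) = true := by
  decide +kernel

/-- Every `U ⊆ S3` lies in one of the segments of `subsetsS3` used by group `2` (kernel-checked). -/ theorem mem_seg_2 : ∀ U : Finset (Fin 9), U ⊆ S3 → U ∈ (subsetsS3.drop 0).take 186 ∨ U ∈ (subsetsS3.drop 186).take 70 := by
  decide +kernel

/-- Class-level check for group `2`: all `(I, U)` with `I` in the group and `U ⊆ S3` pass `classOKpair`. -/ theorem classOK_2 : ∀ I ∈ iGroup2, ∀ U : Finset (Fin 9), U ⊆ S3 → classOKpair I U = true := by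
  intro I hI U hU
  rcases mem_seg_2 U hU with h0 | h1
  · exact List.all_eq_true.mp (List.all_eq_true.mp classOK_2_0 I hI) U h0
  · exact List.all_eq_true.mp (List.all_eq_true.mp classOK_2_1 I hI) U h1

/-- Sure-set group `3` (1 sets). -/
def iGroup3 : List (Finset (Fin 9)) :=
  [{2}]

/-- Kernel chunk `3.0`: every `U` in this segment of `subsetsS3` passes `classOKpair I U` for all `I` of group `3`. -/ theorem classOK_3_0 : iGroup3.all (fun I => ((subsetsS3.drop 0).take 186).all (classOKpair I)) = true := by
  decide +kernel

/-- Kernel chunk `3.1`: every `U` in this segment of `subsetsS3` passes `classOKpair I U` for all `I` of group `3`. -/ theorem classOK_3_1 : iGroup3.all (fun I => ((subsetsS3.drop 186).take 70).all (classOKpair I)) = true := by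
  decide +kernel

/-- Every `U ⊆ S3` lies in one of the segments of `subsetsS3` used by group `3` (kernel-checked). -/ theorem mem_seg_3 : ∀ U : Finset (Fin 9), U ⊆ S3 → U ∈ (subsetsS3.drop 0).take 186 ∨ U ∈ (subsetsS3.drop 186).take 70 := by
  decide +kernel

/-- Class-level check for group `3`: all `(I, U)` with `I` in the group and `U ⊆ S3` pass `classOKpair`. -/ theorem classOK_3 : ∀ I ∈ iGroup3, ∀ U : Finset (Fin 9), U ⊆ S3 → classOKpair I U = true := by
  intro I hI U hU
  rcases mem_seg_3 U hU with h0 | h1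
  · exact List.all_eq_true.mp (List.all_eq_true.mp classOK_3_0 I hI) U h0
  · exact List.all_eq_true.mp (List.all_eq_true.mp classOK_3_1 I hI) U h1

/-- Sure-set group `4` (1 sets). -/
def iGroup4 : List (Finset (Fin 9)) :=
  [{4}]

/-- Kernel chunk `4.0`: every `U` in this segment of `subsetsS3` passes `classOKpair I U` for all `I` of group `4`. -/ theorem classOK_4_0 : iGroup4.all (fun I => ((subsetsS3.drop 0).take 189).all (classOKpair I)) = true := by
  decide +kernel

/-- Kernel chunk `4.1`: every `U` in this segment of `subsetsS3` passes `classOKpair I U` for all `I` of group `4`. -/ theorem classOK_4_1 : iGroup4.all (fun I => ((subsetsS3.drop 189).take 67).all (classOKpair I)) = true := by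
  decide +kernel

/-- Every `U ⊆ S3` lies in one of the segments of `subsetsS3` used by group `4` (kernel-checked). -/ theorem mem_seg_4 : ∀ U : Finset (Fin 9), U ⊆ S3 → U ∈ (subsetsS3.drop 0).take 189 ∨ U ∈ (subsetsS3.drop 189).take 67 := by
  decide +kernel

/-- Class-level check for group `4`: all `(I, U)` with `I` in the group and `U ⊆ S3` pass `classOKpair`. -/ theorem classOK_4 : ∀ I ∈ iGroup4, ∀ U : Finset (Fin 9), U ⊆ S3 → classOKpair I U = true := by
  intro I hI U hU
  rcases mem_seg_4 U hU with h0 | h1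
  · exact List.all_eq_true.mp (List.all_eq_true.mp classOK_4_0 I hI) U h0
  · exact List.all_eq_true.mp (List.all_eq_true.mp classOK_4_1 I hI) U h1

/-- Sure-set group `5` (1 sets). -/
def iGroup5 : List (Finset (Fin 9)) :=
  [{5}]

/-- Kernel chunk `5.0`: every `U` in this segment of `subsetsS3` passes `classOKpair I U` for all `I` of group `5`. -/ theorem classOK_5_0 : iGroup5.all (fun I => ((subsetsS3.drop 0).take 189).all (classOKpair I)) = true := by
  decide +kernel

/-- Kernel chunk `5.1`: every `U` in this segment of `subsetsS3` passes `classOKpair I U` for all `I` of group `5`. -/ theorem classOK_5_1 : iGroup5.all (fun I => ((subsetsS3.drop 189).take 67).all (classOKpair I)) = true := by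
  decide +kernel

/-- Every `U ⊆ S3` lies in one of the segments of `subsetsS3` used by group `5` (kernel-checked). -/ theorem mem_seg_5 : ∀ U : Finset (Fin 9), U ⊆ S3 → U ∈ (subsetsS3.drop 0).take 189 ∨ U ∈ (subsetsS3.drop 189).take 67 := by
  decide +kernel

/-- Class-level check for group `5`: all `(I, U)` with `I` in the group and `U ⊆ S3` pass `classOKpair`. -/ theorem classOK_5 : ∀ I ∈ iGroup5, ∀ U : Finset (Fin 9), U ⊆ S3 → classOKpair I U = true := by
  intro I hI U hU
  rcases mem_seg_5 U hU with h0 | h1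
  · exact List.all_eq_true.mp (List.all_eq_true.mp classOK_5_0 I hI) U h0
  · exact List.all_eq_true.mp (List.all_eq_true.mp classOK_5_1 I hI) U h1

end PercRepro
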